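import Literature.Analysis.FluidPDE.TorusNSLadderInequality
import Literature.Analysis.FunctionSpaces.TorusLadyzhenskaya
import HarnessLib

/-!
# The nonlinear term of the `H_N` ladder on the two-torus, closed by Ladyzhenskaya's inequality
# (no sup-norm of the gradient): `|NL_N(v)| ≤ c_N K (E_N + K + (E_N E_{N+1})^{1/2})`

Analysis/FluidPDE proof file (theorems only; no definitions, no named facts), the two-dimensional companion
of `TorusNSLadderInequality`.  There the nonlinear term
`NL_N(v) = ∑_{|w|=N} ∫ ⟪∂^w((v·∇)v), ∂^w v⟫` of the `H_N`-balance is bounded at every rung and in every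
dimension by `c_N ‖Dv‖_∞ E_N(v)` (Doering–Gibbon 1995, (6.2.25)), a bound that needs an a priori control of
`‖Dv‖_∞`.  In TWO dimensions Ladyzhenskaya's inequality `‖φ‖₄² ≤ c ‖φ‖₂ ‖φ‖_{H¹}` (Ladyzhenskaya 1959,
Lemma 1; Foias–Manley–Rosa–Temam 2001, (A.47); tree `Torus.exists_ladyzhenskaya_const`) closes the ladder
WITHOUT any sup-norm: after the Leibniz expansion of `∂^w((v·∇)v)` (tree `wordDeriv_convect_apply`, the
transport term integrates to zero) every term `∫ ⟪∂^α vⱼ · ∂^β∂ⱼv, ∂^w v⟩` (`|α| ≥ 1`, `|α| + |β| = N`) has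
three factors of derivative orders `(|α|, |β| + 1, N)`; putting the `L²` norm on the factor of LOWEST
order and `L⁴` norms on the other two (Hölder `(2, 4, 4)`), Ladyzhenskaya bounds each `L⁴` norm of a
derivative of order `m` by `(E_m (E_m + E_{m+1}))^{1/4}`, and one obtains, for `N ≥ 2` and any
`K ≥ 1` dominating `E_1(v), …, E_{N−1}(v)`,

  `|NL_N(v)| ≤ c_N · K · (E_N(v) + K + (E_N(v) E_{N+1}(v))^{1/2})`     (`Torus.exists_abs_ladderNonlinear_le_fin_two`)

— LINEAR in `E_N` up to the factor `(E_N E_{N+1})^{1/2}`, which the dissipation `−ν E_{N+1}` of the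
balance absorbs (`≤ (ν/2c)E_{N+1} + (c/2ν)E_N`).  This is the classical mechanism behind the global
`H^m`-regularity of two-dimensional Navier–Stokes flows (Ladyzhenskaya 1959; Temam 1995, Part I §3,
Lemma 3.1–3.2 and Thm. 3.2 for the periodic case; Foias–Manley–Rosa–Temam 2001, App. II.A (A.62)–(A.67);
Kuksin–Shirikyan 2012, Thm. 2.1.18 / Cor. 2.1.20 (smoothness for smooth data); Majda–Bertozzi 2002, §3.3,
Cor. 3.3 in the form `‖ω‖` bounded ⇒ global), used by the sequel `TorusNS2DGlobalBounds` to bound every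
`E_N` of a classical forced solution on `𝕋²` a priori.  Contents:

* `Torus.exists_integral_norm_pow_four_le` — Ladyzhenskaya's inequality in real form for smooth `φ : 𝕋² → F`:
  `∫ ‖φ‖⁴ ≤ C (∫ ‖φ‖²)(∫ ‖φ‖² + ∑ᵢ ∫ ‖∂ᵢφ‖²)` (from the tree's lower-integral statement);
* `Torus.integral_norm_wordDeriv_pow_four_le` & co. — its word form `∫ ‖∂^α v‖⁴ ≤ C E_a (E_a + E_{a+1})`;
* `Torus.integral_mul_mul_le_sqrt_L2_L4_L4` — Hölder `(2, 4, 4)` for continuous nonnegative functions;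
* `Torus.abs_integral_inner_term_le_fin_two` — the per-term bound in the three arrangements;
* `Torus.exists_abs_ladderNonlinear_le_fin_two` — the bound on `NL_N`, `N ≥ 2`.

WHAT THIS IS NOT: no statement in dimension three (there the `L⁴` interpolation costs `E_{m+1}^{3/4}` and
the argument fails — as it must).

## Tree / Mathlib search

Reused: `Torus.exists_ladyzhenskaya_const` (`TorusLadyzhenskaya`), `Torus.ladderNonlinear`,
`Torus.wordDeriv_convect_apply`, `Torus.integral_inner_convect_self_right_eq_zero`, `Torus.lowCommS`,
`Torus.lowerSplits`, `Torus.mem_lowerSplits`, `Torus.list_map_sum_eq_sum_fin`, `Torus.wordEnergy(_succ')`,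
`Torus.integral_norm_sq_wordDeriv_le_wordEnergy`, `Torus.sum_integral_norm_sq_partialDeriv_wordDeriv_le`,
`Torus.wordDeriv_apply_coord`, `Torus.wordDeriv_partialDeriv_comm`, `Torus.integral_mul_le_sqrt_mul_sqrt'`
(`TorusNSLadderInequality`, `TorusWord*`).  `lean search 'ladderNonlinear.*fin_two|Ladyzhenskaya.*wordDeriv'`: no hits.

## References

* O. A. Ladyzhenskaya, *Solution "in the large" of the nonstationary boundary value problem for the
  Navier–Stokes system with two space variables*, CPAM 12 (1959), Lemma 1 and Thm. 1. [Ladyzhenskaya1959]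
* C. Foias, O. Manley, R. Rosa, R. Temam, *Navier–Stokes Equations and Turbulence*, CUP 2001, App. II.A
  (A.47), (A.62)–(A.67). [FoiasManleyRosaTemam2001]
* C. R. Doering, J. D. Gibbon, *Applied Analysis of the Navier–Stokes Equations*, CUP 1995, §6.2
  (6.2.12)–(6.2.27). [DoeringGibbon1995]
* A. J. Majda, A. L. Bertozzi, *Vorticity and Incompressible Flow*, CUP 2002, §3.3, Cor. 3.3. [MajdaBertozziCUP2002]
-/

noncomputable section

open MeasureTheory Set Function
open scoped ContDiff InnerProductSpace RealInnerProductSpace ENNReal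

namespace Literature.Analysis.FluidPDE

namespace Torus

open FunctionSpaces FunctionSpaces.Torus

/-! ## §1 Ladyzhenskaya's inequality in real form for smooth maps -/

section Ladyzhenskaya

variable {F' : Type*} [NormedAddCommGroup F'] [InnerProductSpace ℝ F']

omit [InnerProductSpace ℝ F'] in
/-- Lower integral of the fourth (resp. any) power of the norm of a continuous map on the torus as the
`ofReal` of the Bochner integral. [folklore] -/
private theorem lintegral_enorm_pow_eq_ofReal [NormedSpace ℝ F'] {φ : UnitAddTorus (Fin 2) → F'}
    (hφ : Continuous φ) (n : ℕ) :
    ∫⁻ x, ‖φ x‖ₑ ^ n = ENNReal.ofReal (∫ x, ‖φ x‖ ^ n) := by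
  have hi : Integrable (fun x => ‖φ x‖ ^ n) volume :=
    (show Continuous fun x => ‖φ x‖ ^ n from (continuous_norm.comp hφ).pow n).integrable_unitAddTorus
  rw [ofReal_integral_eq_lintegral_ofReal hi (ae_of_all _ fun x => pow_nonneg (norm_nonneg _) n)]
  refine lintegral_congr fun x => ?_
  rw [← ofReal_norm, ENNReal.ofReal_pow (norm_nonneg _)]

/-- **Ladyzhenskaya's inequality on the flat two-torus, real form**: there is `C ≥ 0` such that for every
smooth map `φ : 𝕋² → F` into a real inner product space
`∫ ‖φ‖⁴ ≤ C (∫ ‖φ‖²)(∫ ‖φ‖² + ∑ᵢ ∫ ‖∂ᵢφ‖²)` (the tree's `Torus.exists_ladyzhenskaya_const` for lower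
integrals, read for smooth — hence bounded — maps; Ladyzhenskaya 1959, Lemma 1; FMRT 2001, (A.47), with the
inhomogeneous `H¹` norm since no mean condition is imposed). [cite: FoiasManleyRosaTemam2001, App. II.A (A.47)] -/
theorem exists_integral_norm_pow_four_le (F' : Type*) [NormedAddCommGroup F'] [InnerProductSpace ℝ F'] :
    ∃ C : ℝ, 0 ≤ C ∧ ∀ φ : UnitAddTorus (Fin 2) → F', IsSmooth φ →
      ∫ x, ‖φ x‖ ^ 4 ≤ C * ((∫ x, ‖φ x‖ ^ 2) * ((∫ x, ‖φ x‖ ^ 2) + ∑ i, ∫ x, ‖Torus.partialDeriv i φ x‖ ^ 2)) := by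
  obtain ⟨C, hC, hLad⟩ := exists_ladyzhenskaya_const F'
  refine ⟨C.toReal, ENNReal.toReal_nonneg, fun φ hφ => ?_⟩
  have h := hLad φ hφ
  have hc : Continuous φ := hφ.continuous
  have hci : ∀ i, Continuous (Torus.partialDeriv i φ) := fun i => (hφ.partialDeriv i).continuous
  rw [lintegral_enorm_pow_eq_ofReal hc 4, lintegral_enorm_pow_eq_ofReal hc 2] at h
  simp_rw [lintegral_enorm_pow_eq_ofReal (hci _) 2] at h
  have h2 : 0 ≤ ∫ x, ‖φ x‖ ^ 2 := integral_nonneg fun _ => by positivity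
  have h4 : 0 ≤ ∫ x, ‖φ x‖ ^ 4 := integral_nonneg fun _ => by positivity
  have hd : ∀ i, 0 ≤ ∫ x, ‖Torus.partialDeriv i φ x‖ ^ 2 := fun i => integral_nonneg fun _ => by positivity
  rw [← ENNReal.ofReal_sum_of_nonneg (fun i _ => hd i), ← ENNReal.ofReal_add h2 (Finset.sum_nonneg fun i _ => hd i),
    ← ENNReal.ofReal_mul h2, ← ENNReal.ofReal_toReal hC, ← ENNReal.ofReal_mul ENNReal.toReal_nonneg] at h
  exact (ENNReal.ofReal_le_ofReal_iff (by positivity)).1 h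

end Ladyzhenskaya

/-! ## §2 Word form: `L⁴` bounds of derivatives by word energies -/

section Words

variable {v : UnitAddTorus (Fin 2) → EuclideanSpace ℝ (Fin 2)}

/-- `∫ ‖∂^α v‖² ≤ E_{|α|}(v)` for a list word `α`. [cite: DoeringGibbon1995, §6.1 (6.1.2)] (bookkeeping) -/
theorem integral_norm_sq_wordDeriv_list_le_wordEnergy (α : List (Fin 2)) (v : UnitAddTorus (Fin 2) → EuclideanSpace ℝ (Fin 2)) :
    ∫ x, ‖wordDeriv α v x‖ ^ 2 ≤ wordEnergy α.length v := by
  have h := integral_norm_sq_wordDeriv_le_wordEnergy (fun i : Fin α.length => α.get i) v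
  rwa [List.ofFn_get] at h

/-- `∑ᵢ ∫ ‖∂ᵢ ∂^α v‖² ≤ E_{|α|+1}(v)` for a list word `α`. [cite: DoeringGibbon1995, §6.1 (6.1.2)] (bookkeeping) -/
theorem sum_integral_norm_sq_partialDeriv_wordDeriv_list_le (α : List (Fin 2))
    (v : UnitAddTorus (Fin 2) → EuclideanSpace ℝ (Fin 2)) :
    ∑ i, ∫ x, ‖Torus.partialDeriv i (wordDeriv α v) x‖ ^ 2 ≤ wordEnergy (α.length + 1) v := by
  have h := sum_integral_norm_sq_partialDeriv_wordDeriv_le (fun i : Fin α.length => α.get i) v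
  rwa [List.ofFn_get] at h

/-- **`L⁴` bound of a word derivative by word energies (2D)**: with the Ladyzhenskaya constant `C`,
`∫ ‖∂^α v‖⁴ ≤ C · E_a(v) · (E_a(v) + E_{a+1}(v))`, `a = |α|`. [cite: FoiasManleyRosaTemam2001, App. II.A (A.47)] -/
theorem integral_norm_wordDeriv_pow_four_le (hv : IsSmooth v) {C : ℝ} (hC0 : 0 ≤ C)
    (hC : ∀ φ : UnitAddTorus (Fin 2) → EuclideanSpace ℝ (Fin 2), IsSmooth φ →
      ∫ x, ‖φ x‖ ^ 4 ≤ C * ((∫ x, ‖φ x‖ ^ 2) * ((∫ x, ‖φ x‖ ^ 2) + ∑ i, ∫ x, ‖Torus.partialDeriv i φ x‖ ^ 2)))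
    (α : List (Fin 2)) :
    ∫ x, ‖wordDeriv α v x‖ ^ 4 ≤ C * (wordEnergy α.length v * (wordEnergy α.length v + wordEnergy (α.length + 1) v)) := by
  have hα : IsSmooth (wordDeriv α v) := isSmooth_wordDeriv hv α
  have h1 : ∫ x, ‖wordDeriv α v x‖ ^ 2 ≤ wordEnergy α.length v := integral_norm_sq_wordDeriv_list_le_wordEnergy α v
  have h2 : ∑ i, ∫ x, ‖Torus.partialDeriv i (wordDeriv α v) x‖ ^ 2 ≤ wordEnergy (α.length + 1) v :=
    sum_integral_norm_sq_partialDeriv_wordDeriv_list_le α v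
  have h0 : 0 ≤ ∫ x, ‖wordDeriv α v x‖ ^ 2 := integral_nonneg fun _ => pow_nonneg (norm_nonneg _) 2
  have hs0 : 0 ≤ ∑ i, ∫ x, ‖Torus.partialDeriv i (wordDeriv α v) x‖ ^ 2 :=
    Finset.sum_nonneg fun i _ => integral_nonneg fun _ => pow_nonneg (norm_nonneg _) 2
  have hE0 : 0 ≤ wordEnergy α.length v := wordEnergy_nonneg _ _
  have h3 : (∫ x, ‖wordDeriv α v x‖ ^ 2) * ((∫ x, ‖wordDeriv α v x‖ ^ 2) +
      ∑ i, ∫ x, ‖Torus.partialDeriv i (wordDeriv α v) x‖ ^ 2) ≤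
      wordEnergy α.length v * (wordEnergy α.length v + wordEnergy (α.length + 1) v) :=
    mul_le_mul h1 (add_le_add h1 h2) (add_nonneg h0 hs0) hE0
  exact (hC _ hα).trans (mul_le_mul_of_nonneg_left h3 hC0)

/-- The same for `∂^β ∂ⱼ v` (a word of length `|β| + 1`):
`∫ ‖∂^β ∂ⱼv‖⁴ ≤ C · E_{b+1}(v) · (E_{b+1}(v) + E_{b+2}(v))`, `b = |β|`. [cite: FoiasManleyRosaTemam2001, App. II.A (A.47)] -/
theorem integral_norm_wordDeriv_partialDeriv_pow_four_le (hv : IsSmooth v) {C : ℝ} (hC0 : 0 ≤ C)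
    (hC : ∀ φ : UnitAddTorus (Fin 2) → EuclideanSpace ℝ (Fin 2), IsSmooth φ →
      ∫ x, ‖φ x‖ ^ 4 ≤ C * ((∫ x, ‖φ x‖ ^ 2) * ((∫ x, ‖φ x‖ ^ 2) + ∑ i, ∫ x, ‖Torus.partialDeriv i φ x‖ ^ 2)))
    (β : List (Fin 2)) (j : Fin 2) :
    ∫ x, ‖wordDeriv β (Torus.partialDeriv j v) x‖ ^ 4 ≤
      C * (wordEnergy (β.length + 1) v * (wordEnergy (β.length + 1) v + wordEnergy (β.length + 2) v)) := by
  have e : wordDeriv β (Torus.partialDeriv j v) = wordDeriv (β ++ [j]) v := by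
    rw [wordDeriv_append]; rfl
  have hl : (β ++ [j]).length = β.length + 1 := by simp
  rw [e]
  have h := integral_norm_wordDeriv_pow_four_le hv hC0 hC (β ++ [j])
  rwa [hl] at h

/-- `∫ ‖∂^β ∂ⱼ v‖² ≤ E_{|β|+1}(v)`. [cite: DoeringGibbon1995, §6.1 (6.1.2)] (bookkeeping) -/
theorem integral_norm_sq_wordDeriv_partialDeriv_le (β : List (Fin 2)) (j : Fin 2)
    (v : UnitAddTorus (Fin 2) → EuclideanSpace ℝ (Fin 2)) :
    ∫ x, ‖wordDeriv β (Torus.partialDeriv j v) x‖ ^ 2 ≤ wordEnergy (β.length + 1) v := by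
  have e : wordDeriv β (Torus.partialDeriv j v) = wordDeriv (β ++ [j]) v := by
    rw [wordDeriv_append]; rfl
  have hl : (β ++ [j]).length = β.length + 1 := by simp
  rw [e, ← hl]
  exact integral_norm_sq_wordDeriv_list_le_wordEnergy _ v

end Words

/-! ## §3 Hölder `(2, 4, 4)` and two elementary square-root inequalities -/

section Holder

/-- **Hölder with exponents `(2, 4, 4)`** for continuous nonnegative functions on the torus:
`∫ f g h ≤ (∫ f²)^{1/2} · ((∫ g⁴)^{1/2} (∫ h⁴)^{1/2})^{1/2}` (two Cauchy–Schwarz steps).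
[cite: DoeringGibbon1995, Appendix A (A.0.12)] -/
theorem integral_mul_mul_le_sqrt_L2_L4_L4 {f g h : UnitAddTorus (Fin 2) → ℝ} (hf : Continuous f)
    (hg : Continuous g) (hh : Continuous h) (hf0 : ∀ x, 0 ≤ f x) (hg0 : ∀ x, 0 ≤ g x) (hh0 : ∀ x, 0 ≤ h x) :
    ∫ x, f x * g x * h x ≤
      Real.sqrt (∫ x, f x ^ 2) * Real.sqrt (Real.sqrt (∫ x, g x ^ 4) * Real.sqrt (∫ x, h x ^ 4)) := by
  have h1 : ∫ x, f x * g x * h x = ∫ x, f x * (g x * h x) := by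
    refine integral_congr_ae (ae_of_all _ fun x => ?_); ring
  rw [h1]
  have hcs1 := integral_mul_le_sqrt_mul_sqrt' (φ := f) (ψ := fun x => g x * h x) hf (hg.mul hh) hf0
    (fun x => mul_nonneg (hg0 x) (hh0 x))
  have hcs2 : ∫ x, (g x * h x) ^ 2 ≤ Real.sqrt (∫ x, g x ^ 4) * Real.sqrt (∫ x, h x ^ 4) := by
    have hg2 : Continuous fun x => g x ^ 2 := hg.pow 2
    have hh2 : Continuous fun x => h x ^ 2 := hh.pow 2
    have := integral_mul_le_sqrt_mul_sqrt' (φ := fun x => g x ^ 2) (ψ := fun x => h x ^ 2) hg2 hh2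
      (fun x => pow_nonneg (hg0 x) 2) (fun x => pow_nonneg (hh0 x) 2)
    have e1 : (fun x => (g x * h x) ^ 2) = fun x => g x ^ 2 * h x ^ 2 := by funext x; ring
    have e2 : ∀ x, (g x ^ 2) ^ 2 = g x ^ 4 := fun x => by ring
    have e3 : ∀ x, (h x ^ 2) ^ 2 = h x ^ 4 := fun x => by ring
    rw [e1]
    simpa only [e2, e3] using this
  exact hcs1.trans (mul_le_mul_of_nonneg_left (Real.sqrt_le_sqrt hcs2) (Real.sqrt_nonneg _))

/-- `√(x (x + y)) ≤ x + √(x y)` for `x, y ≥ 0`. [folklore] -/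
private theorem sqrt_mul_add_le {x y : ℝ} (hx : 0 ≤ x) (hy : 0 ≤ y) :
    Real.sqrt (x * (x + y)) ≤ x + Real.sqrt (x * y) := by
  have hs : 0 ≤ Real.sqrt (x * y) := Real.sqrt_nonneg _
  rw [Real.sqrt_le_left (by positivity)]
  nlinarith [Real.sq_sqrt (mul_nonneg hx hy), Real.sqrt_nonneg (x * y)]

/-- `√E · √(K (2K + E)) ≤ 2 K (E + K)` for `K ≥ 1`, `E ≥ 0`. [folklore] -/
private theorem sqrt_mul_sqrt_le_two_mul {E K : ℝ} (hE : 0 ≤ E) (hK : 1 ≤ K) :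
    Real.sqrt E * Real.sqrt (K * (2 * K + E)) ≤ 2 * K * (E + K) := by
  have hK0 : 0 ≤ K := by linarith
  rw [← Real.sqrt_mul hE, Real.sqrt_le_left (by positivity)]
  nlinarith [mul_nonneg hE hK0, mul_nonneg (mul_nonneg hE hE) hK0, sq_nonneg K, mul_nonneg hE (sq_nonneg K)]

end Holder

/-! ## §4 The per-term bound and the bound on `NL_N` in two dimensions -/

section Nonlinear

variable {v : UnitAddTorus (Fin 2) → EuclideanSpace ℝ (Fin 2)}

/-- A lower commutator unpacked as a finite sum over `Fin (lowerSplits w).length`. [folklore] -/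
private theorem lowCommS_eq_sum_fin' {F : Type*} [NormedAddCommGroup F] [NormedSpace ℝ F] (w : List (Fin 2))
    (a : UnitAddTorus (Fin 2) → ℝ) (U : UnitAddTorus (Fin 2) → F) (x : UnitAddTorus (Fin 2)) :
    lowCommS w a U x = ∑ k : Fin (lowerSplits w).length,
      wordDeriv ((lowerSplits w).get k).1 a x • wordDeriv ((lowerSplits w).get k).2 U x := by
  unfold lowCommS
  rw [list_map_sum_eq_sum_fin, Finset.sum_apply]

/-- **The per-term bound in two dimensions.**  Let `v : 𝕋² → ℝ²` be smooth, `N ≥ 2`, `K ≥ 1` with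
`E_i(v) ≤ K` for `1 ≤ i ≤ N − 1`, and let `C` be a Ladyzhenskaya constant.  Then for words `α ≠ []`, `β`, `w`
with `|α| + |β| = N = |w|` and every `j`,
`|∫ ⟪∂^α vⱼ • ∂^β ∂ⱼv, ∂^w v⟩| ≤ 2 √C · K · (E_N(v) + K + (E_N(v) E_{N+1}(v))^{1/2})`:
Hölder `(2, 4, 4)` with the `L²` norm on the factor of lowest derivative order, and Ladyzhenskaya on the
two `L⁴` factors (Ladyzhenskaya 1959; FMRT 2001, (A.47), the two-dimensional closure of Doering–Gibbon's
(6.2.16)–(6.2.25)). [cite: FoiasManleyRosaTemam2001, App. II.A (A.47)] -/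
theorem abs_integral_inner_term_le_fin_two (hv : IsSmooth v) {C : ℝ} (hC0 : 0 ≤ C)
    (hC : ∀ φ : UnitAddTorus (Fin 2) → EuclideanSpace ℝ (Fin 2), IsSmooth φ →
      ∫ x, ‖φ x‖ ^ 4 ≤ C * ((∫ x, ‖φ x‖ ^ 2) * ((∫ x, ‖φ x‖ ^ 2) + ∑ i, ∫ x, ‖Torus.partialDeriv i φ x‖ ^ 2)))
    {N : ℕ} (hN : 2 ≤ N) {K : ℝ} (hK : 1 ≤ K) (hEK : ∀ i, 1 ≤ i → i ≤ N - 1 → wordEnergy i v ≤ K)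
    {α β w : List (Fin 2)} (hα : α ≠ []) (hαβ : α.length + β.length = N) (hw : w.length = N) (j : Fin 2) :
    |∫ x, ⟪wordDeriv α (fun y => v y j) x • wordDeriv β (Torus.partialDeriv j v) x, wordDeriv w v x⟫| ≤
      2 * Real.sqrt C * K * (wordEnergy N v + K + Real.sqrt (wordEnergy N v * wordEnergy (N + 1) v)) := by
  -- the three nonnegative continuous factors
  set F : UnitAddTorus (Fin 2) → ℝ := fun x => ‖wordDeriv α v x‖ with hF
  set G : UnitAddTorus (Fin 2) → ℝ := fun x => ‖wordDeriv β (Torus.partialDeriv j v) x‖ with hG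
  set H : UnitAddTorus (Fin 2) → ℝ := fun x => ‖wordDeriv w v x‖ with hH
  have hαs : IsSmooth (wordDeriv α v) := isSmooth_wordDeriv hv α
  have hβs : IsSmooth (wordDeriv β (Torus.partialDeriv j v)) := isSmooth_wordDeriv (hv.partialDeriv j) β
  have hws : IsSmooth (wordDeriv w v) := isSmooth_wordDeriv hv w
  have hαjs : IsSmooth (wordDeriv α (fun y => v y j)) := isSmooth_wordDeriv (hv.apply j) α
  have hFc : Continuous F := hαs.continuous.norm
  have hGc : Continuous G := hβs.continuous.norm
  have hHc : Continuous H := hws.continuous.norm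
  have hF0 : ∀ x, 0 ≤ F x := fun x => norm_nonneg _
  have hG0 : ∀ x, 0 ≤ G x := fun x => norm_nonneg _
  have hH0 : ∀ x, 0 ≤ H x := fun x => norm_nonneg _
  -- `|∫ ⟪φ • U, W⟫| ≤ ∫ F G H`
  have hT : |∫ x, ⟪wordDeriv α (fun y => v y j) x • wordDeriv β (Torus.partialDeriv j v) x, wordDeriv w v x⟫| ≤
      ∫ x, F x * G x * H x := by
    refine (abs_integral_le_integral_abs (μ := volume)).trans (integral_mono_of_nonneg (ae_of_all _ fun x => abs_nonneg _)
      (((hFc.mul hGc).mul hHc).integrable_unitAddTorus) (ae_of_all _ fun x => ?_))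
    have hcoord : |wordDeriv α (fun y => v y j) x| ≤ ‖wordDeriv α v x‖ := by
      rw [← wordDeriv_apply_coord hv j α x, ← Real.norm_eq_abs]
      exact PiLp.norm_apply_le (wordDeriv α v x) j
    calc |⟪wordDeriv α (fun y => v y j) x • wordDeriv β (Torus.partialDeriv j v) x, wordDeriv w v x⟫|
        ≤ ‖wordDeriv α (fun y => v y j) x • wordDeriv β (Torus.partialDeriv j v) x‖ * ‖wordDeriv w v x‖ :=
          abs_real_inner_le_norm _ _
      _ = |wordDeriv α (fun y => v y j) x| * G x * H x := by rw [norm_smul, Real.norm_eq_abs]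
      _ ≤ F x * G x * H x := by gcongr
  -- `L²` and `L⁴` facts
  set a := α.length with ha
  set b := β.length with hb
  have ha1 : 1 ≤ a := List.length_pos_iff.2 hα
  have haN : a ≤ N := by omega
  have hbN : b + 1 = N - a + 1 := by omega
  have hF2 : ∫ x, F x ^ 2 ≤ wordEnergy a v := integral_norm_sq_wordDeriv_list_le_wordEnergy α v
  have hG2 : ∫ x, G x ^ 2 ≤ wordEnergy (b + 1) v := integral_norm_sq_wordDeriv_partialDeriv_le β j v
  have hH2 : ∫ x, H x ^ 2 ≤ wordEnergy N v := by
    have := integral_norm_sq_wordDeriv_list_le_wordEnergy w v; rwa [hw] at this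
  have hF4 : ∫ x, F x ^ 4 ≤ C * (wordEnergy a v * (wordEnergy a v + wordEnergy (a + 1) v)) :=
    integral_norm_wordDeriv_pow_four_le hv hC0 hC α
  have hG4 : ∫ x, G x ^ 4 ≤ C * (wordEnergy (b + 1) v * (wordEnergy (b + 1) v + wordEnergy (b + 2) v)) :=
    integral_norm_wordDeriv_partialDeriv_pow_four_le hv hC0 hC β j
  have hH4 : ∫ x, H x ^ 4 ≤ C * (wordEnergy N v * (wordEnergy N v + wordEnergy (N + 1) v)) := by
    have := integral_norm_wordDeriv_pow_four_le hv hC0 hC w; rwa [hw] at this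
  -- abbreviations and signs
  have hE : ∀ n, 0 ≤ wordEnergy n v := fun n => wordEnergy_nonneg n v
  set EN := wordEnergy N v with hEN
  set EN1 := wordEnergy (N + 1) v with hEN1
  have hEN0 : 0 ≤ EN := hE N
  have hEN10 : 0 ≤ EN1 := hE (N + 1)
  have hK0 : 0 ≤ K := by linarith
  have hsC : 0 ≤ Real.sqrt C := Real.sqrt_nonneg C
  have hS0 : 0 ≤ Real.sqrt (EN * EN1) := Real.sqrt_nonneg _
  -- the common final bound from `√E₁ · √(C EN (EN + EN1))`
  have hE1K : wordEnergy 1 v ≤ K := hEK 1 le_rfl (by omega)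
  have hfinal_edge : Real.sqrt (wordEnergy 1 v) * Real.sqrt (C * (EN * (EN + EN1))) ≤
      2 * Real.sqrt C * K * (EN + K + Real.sqrt (EN * EN1)) := by
    have h1 : Real.sqrt (wordEnergy 1 v) ≤ K := by
      rw [Real.sqrt_le_left hK0]; nlinarith
    have h2 : Real.sqrt (C * (EN * (EN + EN1))) ≤ Real.sqrt C * (EN + Real.sqrt (EN * EN1)) := by
      rw [Real.sqrt_mul hC0]
      exact mul_le_mul_of_nonneg_left (sqrt_mul_add_le hEN0 hEN10) hsC
    have hKC : 0 ≤ K * Real.sqrt C := mul_nonneg hK0 hsC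
    calc Real.sqrt (wordEnergy 1 v) * Real.sqrt (C * (EN * (EN + EN1)))
        ≤ K * (Real.sqrt C * (EN + Real.sqrt (EN * EN1))) :=
          mul_le_mul h1 h2 (Real.sqrt_nonneg _) hK0
      _ = (K * Real.sqrt C) * (EN + Real.sqrt (EN * EN1)) := by ring
      _ ≤ (K * Real.sqrt C) * (2 * (EN + K + Real.sqrt (EN * EN1))) :=
          mul_le_mul_of_nonneg_left (by linarith) hKC
      _ = 2 * Real.sqrt C * K * (EN + K + Real.sqrt (EN * EN1)) := by ring
  refine hT.trans ?_
  -- three arrangements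
  rcases eq_or_lt_of_le ha1 with ha1' | ha2
  · -- `a = 1`: `L²` on `F`, `L⁴` on `G`, `H` (both of order `N`)
    have hb1 : b + 1 = N := by omega
    have hb2 : b + 2 = N + 1 := by omega
    rw [hb1, hb2] at hG4
    rw [← ha1'] at hF2
    have h := integral_mul_mul_le_sqrt_L2_L4_L4 hFc hGc hHc hF0 hG0 hH0
    refine h.trans ?_
    have h2 : Real.sqrt (Real.sqrt (∫ x, G x ^ 4) * Real.sqrt (∫ x, H x ^ 4)) ≤
        Real.sqrt (C * (EN * (EN + EN1))) := by
      refine Real.sqrt_le_sqrt ?_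
      calc Real.sqrt (∫ x, G x ^ 4) * Real.sqrt (∫ x, H x ^ 4)
          ≤ Real.sqrt (C * (EN * (EN + EN1))) * Real.sqrt (C * (EN * (EN + EN1))) :=
            mul_le_mul (Real.sqrt_le_sqrt hG4) (Real.sqrt_le_sqrt hH4) (Real.sqrt_nonneg _) (Real.sqrt_nonneg _)
        _ = C * (EN * (EN + EN1)) := Real.mul_self_sqrt (mul_nonneg hC0 (mul_nonneg hEN0 (add_nonneg hEN0 hEN10)))
    calc Real.sqrt (∫ x, F x ^ 2) * Real.sqrt (Real.sqrt (∫ x, G x ^ 4) * Real.sqrt (∫ x, H x ^ 4))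
        ≤ Real.sqrt (wordEnergy 1 v) * Real.sqrt (C * (EN * (EN + EN1))) :=
          mul_le_mul (Real.sqrt_le_sqrt hF2) h2 (Real.sqrt_nonneg _) (Real.sqrt_nonneg _)
      _ ≤ _ := hfinal_edge
  rcases eq_or_lt_of_le haN with haN' | haN2
  · -- `a = N` (`β = []`): `L²` on `G` (order `1`), `L⁴` on `F`, `H` (both of order `N`)
    have hb0 : b + 1 = 1 := by omega
    rw [hb0] at hG2
    rw [haN'] at hF4
    have hperm : ∫ x, F x * G x * H x = ∫ x, G x * F x * H x := by
      refine integral_congr_ae (ae_of_all _ fun x => ?_); ring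
    rw [hperm]
    have h := integral_mul_mul_le_sqrt_L2_L4_L4 hGc hFc hHc hG0 hF0 hH0
    refine h.trans ?_
    have h2 : Real.sqrt (Real.sqrt (∫ x, F x ^ 4) * Real.sqrt (∫ x, H x ^ 4)) ≤
        Real.sqrt (C * (EN * (EN + EN1))) := by
      refine Real.sqrt_le_sqrt ?_
      calc Real.sqrt (∫ x, F x ^ 4) * Real.sqrt (∫ x, H x ^ 4)
          ≤ Real.sqrt (C * (EN * (EN + EN1))) * Real.sqrt (C * (EN * (EN + EN1))) :=
            mul_le_mul (Real.sqrt_le_sqrt hF4) (Real.sqrt_le_sqrt hH4) (Real.sqrt_nonneg _) (Real.sqrt_nonneg _)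
        _ = C * (EN * (EN + EN1)) := Real.mul_self_sqrt (mul_nonneg hC0 (mul_nonneg hEN0 (add_nonneg hEN0 hEN10)))
    calc Real.sqrt (∫ x, G x ^ 2) * Real.sqrt (Real.sqrt (∫ x, F x ^ 4) * Real.sqrt (∫ x, H x ^ 4))
        ≤ Real.sqrt (wordEnergy 1 v) * Real.sqrt (C * (EN * (EN + EN1))) :=
          mul_le_mul (Real.sqrt_le_sqrt hG2) h2 (Real.sqrt_nonneg _) (Real.sqrt_nonneg _)
      _ ≤ _ := hfinal_edge
  · -- `2 ≤ a ≤ N − 1`: `L²` on `H`, `L⁴` on `F`, `G` (orders `a`, `b + 1 ∈ [2, N − 1]`)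
    have ha_le : a ≤ N - 1 := by omega
    have hb1_le : b + 1 ≤ N - 1 := by omega
    have hb1_ge : 1 ≤ b + 1 := by omega
    have hEa : wordEnergy a v ≤ K := hEK a ha1 ha_le
    have hEb : wordEnergy (b + 1) v ≤ K := hEK (b + 1) hb1_ge hb1_le
    -- the next energies are `≤ K + EN` (either an index `≤ N − 1`, or the index `N` itself)
    have hnext : ∀ i, 1 ≤ i → i ≤ N → wordEnergy i v ≤ K + EN := by
      intro i hi1 hiN
      rcases eq_or_lt_of_le hiN with rfl | hlt
      · linarith
      · have := hEK i hi1 (by omega); linarith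
    have hEa1 : wordEnergy (a + 1) v ≤ K + EN := hnext (a + 1) (by omega) (by omega)
    have hEb2 : wordEnergy (b + 2) v ≤ K + EN := hnext (b + 2) (by omega) (by omega)
    have hperm : ∫ x, F x * G x * H x = ∫ x, H x * F x * G x := by
      refine integral_congr_ae (ae_of_all _ fun x => ?_); ring
    rw [hperm]
    have h := integral_mul_mul_le_sqrt_L2_L4_L4 hHc hFc hGc hH0 hF0 hG0
    refine h.trans ?_
    have hX : ∫ x, F x ^ 4 ≤ C * (K * (2 * K + EN)) := by
      refine hF4.trans (mul_le_mul_of_nonneg_left ?_ hC0)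
      exact mul_le_mul hEa (by linarith) (add_nonneg (hE _) (hE _)) hK0
    have hY : ∫ x, G x ^ 4 ≤ C * (K * (2 * K + EN)) := by
      refine hG4.trans (mul_le_mul_of_nonneg_left ?_ hC0)
      exact mul_le_mul hEb (by linarith) (add_nonneg (hE _) (hE _)) hK0
    have h2 : Real.sqrt (Real.sqrt (∫ x, F x ^ 4) * Real.sqrt (∫ x, G x ^ 4)) ≤
        Real.sqrt (C * (K * (2 * K + EN))) := by
      refine Real.sqrt_le_sqrt ?_
      calc Real.sqrt (∫ x, F x ^ 4) * Real.sqrt (∫ x, G x ^ 4)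
          ≤ Real.sqrt (C * (K * (2 * K + EN))) * Real.sqrt (C * (K * (2 * K + EN))) :=
            mul_le_mul (Real.sqrt_le_sqrt hX) (Real.sqrt_le_sqrt hY) (Real.sqrt_nonneg _) (Real.sqrt_nonneg _)
        _ = C * (K * (2 * K + EN)) := Real.mul_self_sqrt (mul_nonneg hC0 (mul_nonneg hK0 (by linarith)))
    calc Real.sqrt (∫ x, H x ^ 2) * Real.sqrt (Real.sqrt (∫ x, F x ^ 4) * Real.sqrt (∫ x, G x ^ 4))
        ≤ Real.sqrt EN * Real.sqrt (C * (K * (2 * K + EN))) :=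
          mul_le_mul (Real.sqrt_le_sqrt hH2) h2 (Real.sqrt_nonneg _) (Real.sqrt_nonneg _)
      _ = Real.sqrt C * (Real.sqrt EN * Real.sqrt (K * (2 * K + EN))) := by
          rw [Real.sqrt_mul hC0]; ring
      _ ≤ Real.sqrt C * (2 * K * (EN + K)) :=
          mul_le_mul_of_nonneg_left (sqrt_mul_sqrt_le_two_mul hEN0 hK) hsC
      _ ≤ 2 * Real.sqrt C * K * (EN + K + Real.sqrt (EN * EN1)) := by
          nlinarith [mul_nonneg (mul_nonneg hsC hK0) hS0]

/-- **The nonlinear term of the `H_N`-ladder in two dimensions** (Ladyzhenskaya's closure of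
Doering–Gibbon's (6.2.12)–(6.2.25)): for every `N ≥ 2` there is `c = c(N) ≥ 0` such that for every smooth
divergence-free `v : 𝕋² → ℝ²` and every `K ≥ 1` with `E_i(v) ≤ K` for `1 ≤ i ≤ N − 1`,
`|NL_N(v)| ≤ c · K · (E_N(v) + K + (E_N(v) E_{N+1}(v))^{1/2})`, `E_n = wordEnergy n`,
`NL_N = ladderNonlinear N` — Leibniz (`wordDeriv_convect_apply`), the transport term vanishes
(`integral_inner_convect_self_right_eq_zero`), and `abs_integral_inner_term_le_fin_two` term by term.  This is
the inequality that makes every `H^m` norm of a two-dimensional flow obey a LINEAR differential inequality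
once the lower norms are bounded (Ladyzhenskaya 1959, Thm. 1; Temam 1995, Part I, §3; FMRT 2001,
(A.62)–(A.67)). [cite: Ladyzhenskaya1959, Lemma 1 and Thm. 1] -/
theorem exists_abs_ladderNonlinear_le_fin_two (N : ℕ) (hN : 2 ≤ N) :
    ∃ c : ℝ, 0 ≤ c ∧ ∀ (v : UnitAddTorus (Fin 2) → EuclideanSpace ℝ (Fin 2)), IsSmooth v → IsDivFree v →
      ∀ K : ℝ, 1 ≤ K → (∀ i, 1 ≤ i → i ≤ N - 1 → wordEnergy i v ≤ K) →
        |ladderNonlinear N v| ≤ c * K * (wordEnergy N v + K + Real.sqrt (wordEnergy N v * wordEnergy (N + 1) v)) := by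
  obtain ⟨C, hC0, hC⟩ := exists_integral_norm_pow_four_le (EuclideanSpace ℝ (Fin 2))
  set c₀ : ℝ := 2 * Real.sqrt C with hc₀
  have hc₀0 : 0 ≤ c₀ := by positivity
  refine ⟨(∑ w : Fin N → Fin 2, ∑ _j : Fin 2, ((lowerSplits (List.ofFn w)).length : ℝ)) * c₀, by positivity,
    fun v hv hdiv K hK hEK => ?_⟩
  set S : ℝ := wordEnergy N v + K + Real.sqrt (wordEnergy N v * wordEnergy (N + 1) v) with hS
  have hS0 : 0 ≤ S := by
    have := wordEnergy_nonneg N v; have := Real.sqrt_nonneg (wordEnergy N v * wordEnergy (N + 1) v)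
    simp only [hS]; linarith
  have hK0 : 0 ≤ K := by linarith
  unfold ladderNonlinear
  have hword : ∀ w : Fin N → Fin 2,
      |∫ x, ⟪wordDeriv (List.ofFn w) (Torus.convect v v) x, wordDeriv (List.ofFn w) v x⟫| ≤
        (∑ _j : Fin 2, ((lowerSplits (List.ofFn w)).length : ℝ)) * c₀ * K * S := by
    intro w
    set W := List.ofFn w with hW
    have hWlen : W.length = N := by simp [hW]
    have hWs : IsSmooth (wordDeriv W v) := isSmooth_wordDeriv hv W
    have hdec : ∫ x, ⟪wordDeriv W (Torus.convect v v) x, wordDeriv W v x⟫ =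
        ∑ j, ∑ k : Fin (lowerSplits W).length,
          ∫ x, ⟪wordDeriv ((lowerSplits W).get k).1 (fun y => v y j) x •
            wordDeriv ((lowerSplits W).get k).2 (Torus.partialDeriv j v) x, wordDeriv W v x⟫ := by
      have hterm : ∀ (j : Fin 2) (k : Fin (lowerSplits W).length), Integrable (fun x =>
          ⟪wordDeriv ((lowerSplits W).get k).1 (fun y => v y j) x •
            wordDeriv ((lowerSplits W).get k).2 (Torus.partialDeriv j v) x, wordDeriv W v x⟫) volume := fun j k =>
        (((isSmooth_wordDeriv (hv.apply j) _).smul' (isSmooth_wordDeriv (hv.partialDeriv j) _)).inner hWs).integrable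
      simp_rw [wordDeriv_convect_apply hv W, inner_add_left, lowCommS_eq_sum_fin', sum_inner]
      rw [integral_add ((hv.convect hWs).inner hWs).integrable
        (integrable_finsetSum _ fun j _ => integrable_finsetSum _ fun k _ => hterm j k),
        integral_inner_convect_self_right_eq_zero hv hdiv hWs, zero_add,
        integral_finsetSum _ fun j _ => integrable_finsetSum _ fun k _ => hterm j k]
      exact Finset.sum_congr rfl fun j _ => integral_finsetSum _ fun k _ => hterm j k
    rw [hdec]
    refine (Finset.abs_sum_le_sum_abs _ _).trans ?_
    rw [Finset.sum_mul, Finset.sum_mul, Finset.sum_mul]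
    refine Finset.sum_le_sum fun j _ => (Finset.abs_sum_le_sum_abs _ _).trans ?_
    have hk : ∀ k : Fin (lowerSplits W).length,
        |∫ x, ⟪wordDeriv ((lowerSplits W).get k).1 (fun y => v y j) x •
            wordDeriv ((lowerSplits W).get k).2 (Torus.partialDeriv j v) x, wordDeriv W v x⟫| ≤ c₀ * K * S := by
      intro k
      obtain ⟨hne, hlen⟩ := mem_lowerSplits (List.get_mem (lowerSplits W) k)
      rw [hWlen] at hlen
      have := abs_integral_inner_term_le_fin_two hv hC0 hC hN hK hEK hne hlen hWlen j
      simpa only [hc₀, hS, mul_assoc] using this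
    calc ∑ k : Fin (lowerSplits W).length, |∫ x, ⟪wordDeriv ((lowerSplits W).get k).1 (fun y => v y j) x •
            wordDeriv ((lowerSplits W).get k).2 (Torus.partialDeriv j v) x, wordDeriv W v x⟫|
        ≤ ∑ _k : Fin (lowerSplits W).length, c₀ * K * S := Finset.sum_le_sum fun k _ => hk k
      _ = ((lowerSplits W).length : ℝ) * c₀ * K * S := by
          rw [Finset.sum_const, Finset.card_univ, Fintype.card_fin, nsmul_eq_mul]; ring
  calc |∑ w : Fin N → Fin 2, ∫ x, ⟪wordDeriv (List.ofFn w) (Torus.convect v v) x, wordDeriv (List.ofFn w) v x⟫|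
      ≤ ∑ w : Fin N → Fin 2, |∫ x, ⟪wordDeriv (List.ofFn w) (Torus.convect v v) x, wordDeriv (List.ofFn w) v x⟫| :=
        Finset.abs_sum_le_sum_abs _ _
    _ ≤ ∑ w : Fin N → Fin 2, (∑ _j : Fin 2, ((lowerSplits (List.ofFn w)).length : ℝ)) * c₀ * K * S :=
        Finset.sum_le_sum fun w _ => hword w
    _ = (∑ w : Fin N → Fin 2, ∑ _j : Fin 2, ((lowerSplits (List.ofFn w)).length : ℝ)) * c₀ * K * S := by
        rw [Finset.sum_mul, Finset.sum_mul, Finset.sum_mul]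

end Nonlinear

end Torus

end Literature.Analysis.FluidPDE

end
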